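import Summits.QuantumFields.BalabanUV.Beta.FP.WSlotSplit
import Summits.QuantumFields.BalabanUV.Beta.KernelWardRelative

/-!
# `BalabanUV.Beta.FP.WSlotSplitFamily` — road «FP» for binder row D1, ROW (W-SPLIT) of R-FP-38, COMPANION to the owner's `FP/WSlotSplit` (owner word
# «GO companion», journal 2026-08-21T07:00:54Z): THE FINITE-FAMILY FORM — `Wt = W₀ + Σ_i Wx i` with defect `Cg + Σ_i B i` ((G8) «RESP × ONE-POINT» and
# (G-mix-W) «MIXED ONE-POINT» as two indices of ONE call) — and the `∃ U ≥ 0, ∃ Cg` form in the junction END's shape (`Bnear ↦ Bnear + Σ_i B i`)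

HONEST DEPENDENCY (page 1, mandatory): continuum YM on T⁴ ⇐ BetaPertH ∧ nine spine estimates (0/9 proved); BetaPertH ⇐ (D1) ∧ (D4) ∧ CAP+tail;
G-an2-4 gates asym, D1 and NE2/3/4.  HONEST FRAMING (cell contract, verbatim): «discharging `BetaPertH` makes Bałaban's UV stability UNCONDITIONAL —
a real constructive-QFT result; it is NOT the continuum limit and NOT the Clay problem.»  THIS MODULE DISCHARGES NOTHING of the wall: it is [folklore]
bookkeeping BY NAME over the owner's `WSlotSplit` (`hessKer_add_W`, `TPerfOf_add_W`, `hasym_of_add_bounded` — NOT restated) and `KernelWardRelative`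
(`loc_finset_sum`, `tadpole_finset_sum`), `B12Beta.secondMoment` additivity over a finite family under `MomentSummable`, and the triangle inequality.
The extra pieces' BOUNDS `B i` (rows (G8), (G-mix-W)) and the slot decomposition stay DISPLAYED HYPOTHESES.  No `def`, no `def … : Prop`, nothing cited,
0 sorry; 0∕4 row-D1 binders; NOT (G8)∕(G-mix-W), NOT (ASYMP) for the literal, NOT D1, NOT BetaPertH, NOT continuum, NOT Clay.  «not in print; our bookkeeping».

ABSOLUTE RULE (cell charter, verbatim): «No internally-minted statement may enter as a cited fact. Every hypothesis is either kernel-proved in this package or a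
verbatim quotation of a PUBLISHED theorem with page reference. The manuscript(s) under audit are NOT citable for their own disputed steps — they are the thing
under adjudication; programme-internal (2001/route/tribunal) claims are never citable.»

WHAT.  §1: the extra piece `z ↦ ½·tadpole A (Wx μ 0 ν z)` IS `hessKer A 0 Wx` (first slot OFF; the two spellings of R-FP-38 agree; with the first slot ON
the bubble `−½·bubble(S,S)` would be counted twice) — this is ALREADY the tree's `PerfectBubbleExpansion.hessKer_zero_V`, cited by name, not restated.  §2 [folklore] **`hessKer_add_sum_W`**, **`TPerfOf_add_sum_W`** — the W-slot split
over a finite family (`Fintype ι`, sum over `univ`) — and their MEMBER-LEVEL forms `hessKer_split_W_members`, `TPerfOf_split_W_members` (the split asked only of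
the `(μ,0;ν,z)` members, in `MKer`: no algebra on the 4-fold function type of bi-tables).  §3 [folklore] `momentSummable_finset_sum`, `secondMoment_finset_sum`, **`hasym_of_add_sum_bounded`** —
(ASYMP) transfers across finitely many bounded extra pieces, defect `Cg + Σ_i B i`.  §4 [our object] **`hasym_TPerfOf_of_wslot_split_sum`** (at `K_m := KPerf…m`,
`N := Lc^m`, ANY `S m`) and **`hasym_TPerfOf_of_wslot_split_sum_exists`** (the `∃ U ≥ 0, ∃ Cg, … ≤ (U + Bnear) + Cg` shape of
`FineSplitJunctionNearFar`∕`…Ledger`∕`FineHessianNearLedger`, with `Bnear ↦ Bnear + Σ_i B i`).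
Provenance: D1 formalisation swarm LEAF PROVER 06, unit `b2b-balaban-beta-d1-formalise-leaf-06` gen 10, 2026-08-21; owner GO l.28614 (2).
-/

noncomputable section

namespace Summit.QuantumFields.BalabanUV.Beta.FP.WSlotSplitFamily

open Finset
open scoped BigOperators
open Literature.MathematicalPhysics.QuantumFieldTheory.Balaban1983to89
open Literature.MathematicalPhysics.QuantumFieldTheory.Balaban1983to89.Beta
open Literature.MathematicalPhysics.QuantumFieldTheory.Balaban1983to89.B12Normalization (stepBal)
open ExpKernelCalculus (Site MKer Decays BiLoc tadpole bubble hessKer)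
open OneStepResolventKernel (Fib)
open AxialDressing (axDressK axVertexOfK decays_axDressK)
open DyadicShell (Pt)
open Summit.QuantumFields.BalabanUV.Beta.TameKernelCalculus (Spr Loc tadpole_add)
open Summit.QuantumFields.BalabanUV.Beta.KernelWardRelative (loc_finset_sum tadpole_finset_sum)
open Summit.QuantumFields.BalabanUV.Beta.GAN24.CombesThomas (sfStep smStep)
open Summit.QuantumFields.BalabanUV.Beta.FP.PerfectObjectsT (KPerf TPerfOf)
open Summit.QuantumFields.BalabanUV.Beta.FP.StepLawKHolds (exists_decays_KPerf_holds)
open Summit.QuantumFields.BalabanUV.Beta.FP.WSlotSplit (hessKer_add_W TPerfOf_add_W hasym_of_add_bounded)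

/-! ## §1 The extra piece is the first-slot-off kernel — ALREADY IN THE TREE: `PerfectBubbleExpansion.hessKer_zero_V`
(`hessKer A 0 W μ ν z = ½·tadpole A (W μ 0 ν z)`); not restated here (cite it BY NAME). -/

/-! ## §2 The W-slot split over a finite family -/

section Family

variable {ι : Type*} [Fintype ι] {D : ℕ} {F : Type*} [Fintype F]

/-- [folklore] **`hessKer` OVER A FINITE FAMILY OF EXTRA SLOTS**: `Spr A`, the `(μ,0;ν,z)` members of `W₀` and of every `Wx i` localised ⟹
`hessKer A V (W₀ + Σ_i Wx i) μ ν z = hessKer A V W₀ μ ν z + Σ_i ½·tadpole A (Wx i μ 0 ν z)` (`WSlotSplit.hessKer_add_W` + `KernelWardRelative.tadpole_finset_sum`). -/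
theorem hessKer_add_sum_W {A : MKer D F} (hA : Spr A) (V : Fin D → Site D → MKer D F) {W₀ : Fin D → Site D → Fin D → Site D → MKer D F}
    {Wx : ι → Fin D → Site D → Fin D → Site D → MKer D F} (μ ν : Fin D) (z : Site D) (h₀ : Loc (W₀ μ 0 ν z)) (hx : ∀ i, Loc (Wx i μ 0 ν z)) :
    hessKer A V (W₀ + ∑ i, Wx i) μ ν z = hessKer A V W₀ μ ν z + ∑ i, (1 / 2 : ℝ) * tadpole A (Wx i μ 0 ν z) := by
  have hsum : (∑ i, Wx i) μ 0 ν z = ∑ i, Wx i μ 0 ν z := by simp only [Finset.sum_apply]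
  have hloc : Loc ((∑ i, Wx i) μ 0 ν z) := by rw [hsum]; exact loc_finset_sum _ hx
  rw [hessKer_add_W hA V μ ν z h₀ hloc, hsum, tadpole_finset_sum _ hA hx, Finset.mul_sum]

/-- [folklore] **`TPerfOf` OVER A FINITE FAMILY OF EXTRA SLOTS** (`D = 4`): decaying `K` (rate `> 0`), `1 ≤ n`, ANY `S` ⟹
`TPerfOf n K S (W₀ + Σ_i Wx i) μ ν z = TPerfOf n K S W₀ μ ν z + Σ_i ½·tadpole (axDressK n K) (Wx i μ 0 ν z)`. -/
theorem TPerfOf_add_sum_W {n : ℕ} (hn : 1 ≤ n) {K : MKer (3 + 1) (Fib 3)} {C δ : ℝ} (hK : Decays K C δ) (hδ : 0 < δ)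
    (S : Fin (3 + 1) → (Fin (3 + 1) → ℤ) → MKer (3 + 1) (Fib 3))
    {W₀ : Fin (3 + 1) → (Fin (3 + 1) → ℤ) → Fin (3 + 1) → (Fin (3 + 1) → ℤ) → MKer (3 + 1) (Fib 3)}
    {Wx : ι → Fin (3 + 1) → (Fin (3 + 1) → ℤ) → Fin (3 + 1) → (Fin (3 + 1) → ℤ) → MKer (3 + 1) (Fib 3)}
    (μ ν : Fin (3 + 1)) (z : Fin (3 + 1) → ℤ) (h₀ : Loc (W₀ μ 0 ν z)) (hx : ∀ i, Loc (Wx i μ 0 ν z)) :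
    TPerfOf n K S (W₀ + ∑ i, Wx i) μ ν z = TPerfOf n K S W₀ μ ν z + ∑ i, (1 / 2 : ℝ) * tadpole (axDressK n K) (Wx i μ 0 ν z) := by
  have hA : Spr (axDressK n K) := ⟨_, δ, hδ, decays_axDressK hn hK hδ.le⟩
  exact hessKer_add_sum_W hA _ μ ν z h₀ hx

/-- [folklore] **MEMBER-LEVEL FORM** (the hypothesis the road instance uses: the split is asked only of the `(μ,0;ν,z)` members, in `MKer`, so that no algebra on
the 4-fold function type of bi-tables is needed): `W μ 0 ν z = W₀ μ 0 ν z + Σ_i Wx i μ 0 ν z` ⟹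
`hessKer A V W μ ν z = hessKer A V W₀ μ ν z + Σ_i ½·tadpole A (Wx i μ 0 ν z)`. -/
theorem hessKer_split_W_members {A : MKer D F} (hA : Spr A) (V : Fin D → Site D → MKer D F) {W W₀ : Fin D → Site D → Fin D → Site D → MKer D F}
    {Wx : ι → Fin D → Site D → Fin D → Site D → MKer D F} (μ ν : Fin D) (z : Site D)
    (hsplit : W μ 0 ν z = W₀ μ 0 ν z + ∑ i, Wx i μ 0 ν z) (h₀ : Loc (W₀ μ 0 ν z)) (hx : ∀ i, Loc (Wx i μ 0 ν z)) :
    hessKer A V W μ ν z = hessKer A V W₀ μ ν z + ∑ i, (1 / 2 : ℝ) * tadpole A (Wx i μ 0 ν z) := by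
  simp only [ExpKernelCalculus.hessKer]
  rw [hsplit, tadpole_add hA h₀ (loc_finset_sum _ hx), tadpole_finset_sum _ hA hx, ← Finset.mul_sum]
  ring

/-- [folklore] **MEMBER-LEVEL FORM FOR `TPerfOf`** (`D = 4`). -/
theorem TPerfOf_split_W_members {n : ℕ} (hn : 1 ≤ n) {K : MKer (3 + 1) (Fib 3)} {C δ : ℝ} (hK : Decays K C δ) (hδ : 0 < δ)
    (S : Fin (3 + 1) → (Fin (3 + 1) → ℤ) → MKer (3 + 1) (Fib 3))
    {W W₀ : Fin (3 + 1) → (Fin (3 + 1) → ℤ) → Fin (3 + 1) → (Fin (3 + 1) → ℤ) → MKer (3 + 1) (Fib 3)}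
    {Wx : ι → Fin (3 + 1) → (Fin (3 + 1) → ℤ) → Fin (3 + 1) → (Fin (3 + 1) → ℤ) → MKer (3 + 1) (Fib 3)}
    (μ ν : Fin (3 + 1)) (z : Fin (3 + 1) → ℤ)
    (hsplit : W μ 0 ν z = W₀ μ 0 ν z + ∑ i, Wx i μ 0 ν z) (h₀ : Loc (W₀ μ 0 ν z)) (hx : ∀ i, Loc (Wx i μ 0 ν z)) :
    TPerfOf n K S W μ ν z = TPerfOf n K S W₀ μ ν z + ∑ i, (1 / 2 : ℝ) * tadpole (axDressK n K) (Wx i μ 0 ν z) := by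
  have hA : Spr (axDressK n K) := ⟨_, δ, hδ, decays_axDressK hn hK hδ.le⟩
  unfold TPerfOf
  exact hessKer_split_W_members hA _ μ ν z hsplit h₀ hx

end Family

/-! ## §3 (ASYMP) transfers across finitely many bounded extra pieces -/

section Transfer

variable {ι : Type*} [Fintype ι]

omit [Fintype ι] in
/-- [folklore] a finite sum of `MomentSummable` kernels is `MomentSummable` (the `(μ,ν)` channel of the pointwise sum). -/
theorem momentSummable_finset_sum (s : Finset ι) {T : ι → B12Beta.Kernel 4} {μ ν : Fin 4} (h : ∀ i ∈ s, B14DeltaBeta.MomentSummable (T i) μ ν) :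
    B14DeltaBeta.MomentSummable (fun a b z => ∑ i ∈ s, T i a b z) μ ν := by
  unfold B14DeltaBeta.MomentSummable at h ⊢
  have e : (fun x : Fin 4 → ℤ => (∑ i ∈ s, T i μ ν x) * (x μ : ℝ) * (x ν : ℝ)) = fun x => ∑ i ∈ s, T i μ ν x * (x μ : ℝ) * (x ν : ℝ) := by
    funext x; rw [Finset.sum_mul, Finset.sum_mul]
  rw [e]
  exact summable_sum h

omit [Fintype ι] in
/-- [folklore] `secondMoment (Σ_{i∈s} T i) μ ν = Σ_{i∈s} secondMoment (T i) μ ν` under `MomentSummable` of every summand. -/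
theorem secondMoment_finset_sum (s : Finset ι) {T : ι → B12Beta.Kernel 4} {μ ν : Fin 4} (h : ∀ i ∈ s, B14DeltaBeta.MomentSummable (T i) μ ν) :
    B12Beta.secondMoment (fun a b z => ∑ i ∈ s, T i a b z) μ ν = ∑ i ∈ s, B12Beta.secondMoment (T i) μ ν := by
  unfold B12Beta.secondMoment
  have e : (fun x : Fin 4 → ℤ => (∑ i ∈ s, T i μ ν x) * (x μ : ℝ) * (x ν : ℝ)) = fun x => ∑ i ∈ s, T i μ ν x * (x μ : ℝ) * (x ν : ℝ) := by
    funext x; rw [Finset.sum_mul, Finset.sum_mul]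
  rw [e]
  exact (hasSum_sum fun i hi => (h i hi).hasSum).tsum_eq

/-- [folklore] **(ASYMP) TRANSFERS ACROSS FINITELY MANY BOUNDED EXTRA PIECES**: `T m μ ν = T₀ m μ ν + Σ_i Tx i m μ ν` pointwise, all pieces `MomentSummable`,
`|m2(T₀ m) − m·s| ≤ Cg`, `|m2(Tx i m)| ≤ B i` ⟹ `|m2(T m) − m·s| ≤ Cg + Σ_i B i` (`WSlotSplit.hasym_of_add_bounded` with the summed extra piece). -/
theorem hasym_of_add_sum_bounded {T T₀ : ℕ → B12Beta.Kernel 4} {Tx : ι → ℕ → B12Beta.Kernel 4} {μ ν : Fin 4} {s Cg : ℝ} {B : ι → ℝ}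
    (hT : ∀ m : ℕ, 1 ≤ m → ∀ z, T m μ ν z = T₀ m μ ν z + ∑ i, Tx i m μ ν z)
    (hs₀ : ∀ m : ℕ, 1 ≤ m → B14DeltaBeta.MomentSummable (T₀ m) μ ν)
    (hsx : ∀ i, ∀ m : ℕ, 1 ≤ m → B14DeltaBeta.MomentSummable (Tx i m) μ ν)
    (h₀ : ∀ m : ℕ, 1 ≤ m → |B12Beta.secondMoment (T₀ m) μ ν - (m : ℝ) * s| ≤ Cg)
    (hx : ∀ i, ∀ m : ℕ, 1 ≤ m → |B12Beta.secondMoment (Tx i m) μ ν| ≤ B i) :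
    ∀ m : ℕ, 1 ≤ m → |B12Beta.secondMoment (T m) μ ν - (m : ℝ) * s| ≤ Cg + ∑ i, B i := by
  refine hasym_of_add_bounded (T₀ := T₀) (T₁ := fun m a b z => ∑ i, Tx i m a b z) hT hs₀
    (fun m hm => momentSummable_finset_sum _ fun i _ => hsx i m hm) h₀ fun m hm => ?_
  rw [secondMoment_finset_sum _ fun i _ => hsx i m hm]
  exact (Finset.abs_sum_le_sum_abs _ _).trans (Finset.sum_le_sum fun i _ => hx i m hm)

end Transfer

/-! ## §4 At the road's objects: the finite-family W-slot split and its `∃`-form -/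

section Road

variable {ι : Type*} [Fintype ι] {Lc : ℕ} [NeZero Lc]

/-- [our object] **(ASYMP) FOR THE FULL SECOND-ORDER SLOT ⟸ (ASYMP) FOR THE `W₀`-KERNEL ∧ FINITELY MANY BOUNDED EXTRA COARSE PIECES** (row (W-SPLIT),
finite-family form of `WSlotSplit.hasym_TPerfOf_of_wslot_split`).  Objects: `K_m := KPerf Lc (sfStep Lc) (smStep 3 Lc) m`, `N := Lc^m`, ANY `S m`; slot split asked of the `(μ,0;ν,z)` MEMBERS only,
`Wt m μ 0 ν z = W₀ m μ 0 ν z + Σ_i Wx i m μ 0 ν z` (DISPLAYED — follows from a function-level split by evaluation; the road: `W₀ m := vertex2OfK K_m N (Wf m)`, `Wx i m` = the response ∕ mixed summands, `i ∈ {(G8), (G-mix-W)}`); DISPLAYED: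
`Loc` letters of the slots' `(μ,0;ν,z)` members, `MomentSummable` of the `W₀`-kernel and of each extra piece `z ↦ ½·tadpole (axDressK N K_m) (Wx i m μ 0 ν z)`,
(ASYMP) for the `W₀`-kernel with defect `Cg`, bounds `B i`.  CONCLUSION: (ASYMP) for `TPerfOf N K_m (S m) (Wt m)` with defect `Cg + Σ_i B i`. -/
theorem hasym_TPerfOf_of_wslot_split_sum (hLc : 2 ≤ Lc)
    {S : ℕ → Fin (3 + 1) → (Fin (3 + 1) → ℤ) → MKer (3 + 1) (Fib 3)}
    {Wt W₀ : ℕ → Fin (3 + 1) → (Fin (3 + 1) → ℤ) → Fin (3 + 1) → (Fin (3 + 1) → ℤ) → MKer (3 + 1) (Fib 3)}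
    {Wx : ι → ℕ → Fin (3 + 1) → (Fin (3 + 1) → ℤ) → Fin (3 + 1) → (Fin (3 + 1) → ℤ) → MKer (3 + 1) (Fib 3)}
    {μ ν : Fin (3 + 1)}
    (hsplit : ∀ m : ℕ, 1 ≤ m → ∀ z : Fin (3 + 1) → ℤ, Wt m μ 0 ν z = W₀ m μ 0 ν z + ∑ i, Wx i m μ 0 ν z)
    (hloc₀ : ∀ m : ℕ, 1 ≤ m → ∀ z, Loc (W₀ m μ 0 ν z)) (hlocx : ∀ i, ∀ m : ℕ, 1 ≤ m → ∀ z, Loc (Wx i m μ 0 ν z))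
    (hs₀ : ∀ m : ℕ, 1 ≤ m → B14DeltaBeta.MomentSummable
      (TPerfOf (Lc ^ m) (KPerf (d := 3) Lc (sfStep Lc) (smStep 3 Lc) m) (S m) (W₀ m)) μ ν)
    (hsx : ∀ i, ∀ m : ℕ, 1 ≤ m → B14DeltaBeta.MomentSummable
      (fun μ' ν' z => (1 / 2 : ℝ) * tadpole (axDressK (Lc ^ m) (KPerf (d := 3) Lc (sfStep Lc) (smStep 3 Lc) m)) (Wx i m μ' 0 ν' z)) μ ν)
    {s Cg : ℝ} {B : ι → ℝ}
    (hasym₀ : ∀ m : ℕ, 1 ≤ m →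
      |B12Beta.secondMoment (TPerfOf (Lc ^ m) (KPerf (d := 3) Lc (sfStep Lc) (smStep 3 Lc) m) (S m) (W₀ m)) μ ν - (m : ℝ) * s| ≤ Cg)
    (hextra : ∀ i, ∀ m : ℕ, 1 ≤ m →
      |B12Beta.secondMoment
          (fun μ' ν' z => (1 / 2 : ℝ) * tadpole (axDressK (Lc ^ m) (KPerf (d := 3) Lc (sfStep Lc) (smStep 3 Lc) m)) (Wx i m μ' 0 ν' z)) μ ν| ≤ B i) :
    ∀ m : ℕ, 1 ≤ m →
      |B12Beta.secondMoment (TPerfOf (Lc ^ m) (KPerf (d := 3) Lc (sfStep Lc) (smStep 3 Lc) m) (S m) (Wt m)) μ ν - (m : ℝ) * s| ≤ Cg + ∑ i, B i := by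
  refine hasym_of_add_sum_bounded (T₀ := fun m => TPerfOf (Lc ^ m) (KPerf (d := 3) Lc (sfStep Lc) (smStep 3 Lc) m) (S m) (W₀ m))
    (Tx := fun i m μ' ν' z => (1 / 2 : ℝ) * tadpole (axDressK (Lc ^ m) (KPerf (d := 3) Lc (sfStep Lc) (smStep 3 Lc) m)) (Wx i m μ' 0 ν' z))
    (fun m hm z => ?_) hs₀ hsx hasym₀ hextra
  have hn1 : 1 ≤ Lc ^ m := Nat.one_le_pow _ _ (by omega)
  obtain ⟨CK, δK, hδK, hK⟩ := exists_decays_KPerf_holds hLc hm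
  exact TPerfOf_split_W_members hn1 hK hδK (S m) μ ν z (hsplit m hm z) (hloc₀ m hm z) (fun i => hlocx i m hm z)

/-- [our object] **THE `∃`-FORM IN THE JUNCTION END's SHAPE**: if the `W₀`-kernel's (ASYMP) comes as `∃ U ≥ 0, ∃ Cg, ∀ m ≥ 1, |…| ≤ (U + Bnear) + Cg`
(`FineSplitJunctionNearFar.hasym_PiBF_vertex2OfK_of_near_far`, `FineSplitJunctionLedger.…_of_far_nearPieces`, `FineHessianNearLedger.hasym_PiBF_vertex2OfK_of_sliceLedger`),
the full slot's (ASYMP) comes in the same shape with `Bnear ↦ Bnear + Σ_i B i`. -/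
theorem hasym_TPerfOf_of_wslot_split_sum_exists (hLc : 2 ≤ Lc)
    {S : ℕ → Fin (3 + 1) → (Fin (3 + 1) → ℤ) → MKer (3 + 1) (Fib 3)}
    {Wt W₀ : ℕ → Fin (3 + 1) → (Fin (3 + 1) → ℤ) → Fin (3 + 1) → (Fin (3 + 1) → ℤ) → MKer (3 + 1) (Fib 3)}
    {Wx : ι → ℕ → Fin (3 + 1) → (Fin (3 + 1) → ℤ) → Fin (3 + 1) → (Fin (3 + 1) → ℤ) → MKer (3 + 1) (Fib 3)}
    {μ ν : Fin (3 + 1)}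
    (hsplit : ∀ m : ℕ, 1 ≤ m → ∀ z : Fin (3 + 1) → ℤ, Wt m μ 0 ν z = W₀ m μ 0 ν z + ∑ i, Wx i m μ 0 ν z)
    (hloc₀ : ∀ m : ℕ, 1 ≤ m → ∀ z, Loc (W₀ m μ 0 ν z)) (hlocx : ∀ i, ∀ m : ℕ, 1 ≤ m → ∀ z, Loc (Wx i m μ 0 ν z))
    (hs₀ : ∀ m : ℕ, 1 ≤ m → B14DeltaBeta.MomentSummable
      (TPerfOf (Lc ^ m) (KPerf (d := 3) Lc (sfStep Lc) (smStep 3 Lc) m) (S m) (W₀ m)) μ ν)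
    (hsx : ∀ i, ∀ m : ℕ, 1 ≤ m → B14DeltaBeta.MomentSummable
      (fun μ' ν' z => (1 / 2 : ℝ) * tadpole (axDressK (Lc ^ m) (KPerf (d := 3) Lc (sfStep Lc) (smStep 3 Lc) m)) (Wx i m μ' 0 ν' z)) μ ν)
    {s Bnear : ℝ} {B : ι → ℝ}
    (hasym₀ : ∃ U : ℝ, 0 ≤ U ∧ ∃ Cg : ℝ, ∀ m : ℕ, 1 ≤ m →
      |B12Beta.secondMoment (TPerfOf (Lc ^ m) (KPerf (d := 3) Lc (sfStep Lc) (smStep 3 Lc) m) (S m) (W₀ m)) μ ν - (m : ℝ) * s| ≤ (U + Bnear) + Cg)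
    (hextra : ∀ i, ∀ m : ℕ, 1 ≤ m →
      |B12Beta.secondMoment
          (fun μ' ν' z => (1 / 2 : ℝ) * tadpole (axDressK (Lc ^ m) (KPerf (d := 3) Lc (sfStep Lc) (smStep 3 Lc) m)) (Wx i m μ' 0 ν' z)) μ ν| ≤ B i) :
    ∃ U : ℝ, 0 ≤ U ∧ ∃ Cg : ℝ, ∀ m : ℕ, 1 ≤ m →
      |B12Beta.secondMoment (TPerfOf (Lc ^ m) (KPerf (d := 3) Lc (sfStep Lc) (smStep 3 Lc) m) (S m) (Wt m)) μ ν - (m : ℝ) * s|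
        ≤ (U + (Bnear + ∑ i, B i)) + Cg := by
  obtain ⟨U, hU, Cg, h⟩ := hasym₀
  refine ⟨U, hU, Cg, fun m hm => ?_⟩
  have h' := hasym_TPerfOf_of_wslot_split_sum hLc hsplit hloc₀ hlocx hs₀ hsx (Cg := (U + Bnear) + Cg) h hextra m hm
  linarith

end Road

end Summit.QuantumFields.BalabanUV.Beta.FP.WSlotSplitFamily

end
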